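import Summits.QuantumFields.YangMills.Theorems.ToronSmallBallOwnAxisShiftLadder
import Summits.QuantumFields.YangMills.Theorems.ToronSmallBallOwnAxisShiftAngle
import Summits.QuantumFields.YangMills.Theorems.QuantileBitPuritySectorGoodDefs
import Summits.QuantumFields.YangMills.Theorems.LuscherReductionRunningReductionLatticeLinkKernel
import HarnessLib

/-!
# The own-axis sheet shift: the good-field event supplies the cost hypotheses and the non-centrality floor

Support module (`--supports` stmt-QuantumFields-24089, `ToronSmallBall.PeriodicOffCoreStripWindowDeep`; seat ym-dw-p1 g15).  The tree's good-field event
`TT.goodEvent n z s t` (all slice actions `< s`, interior bonds and the seam bond linkwise `t`-close in Frobenius norm) is translated into the quaternion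
hypotheses of the cost module (`ToronSmallBallOwnAxisShiftCost`), and the off-core condition on the `x`-holonomy through the origin of slice `0` is
PROPAGATED to every plane line of every slice:

* §1 dictionary: `S(U) ≤ s ⇒ ‖q(U_p) − 1‖ ≤ √s` for EVERY plaquette symbol `(y; i, j)` (also `i = j`, `i > j`); Frobenius `t`-closeness ⇒ quaternion
  `t`-closeness; the three clauses of `goodEvent n 0 s t` in this currency (`hP`, `hTi`, `hTs` of `OwnAxis.seamDensity_le_exp_mul_ownShift`);
* §2 propagation: transverse ladders move `‖Im q(P_x)‖` by at most `Lε` per lattice step (`2L²ε` to reach any plane site from the origin), time ladders by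
  at most `Lτ` per slice (`nLτ` along the ring); ★ `norm_imVec_lineHolonomy_ge_of_goodEvent`:
  on `goodEvent`, `‖Im q(P_x(U_t))‖ ≥ polDist(U_0)/2 − 2L²√s − nLt` for every slice `t` and plane site `x`;
* §3 ★ `lineHolonomy_mem_shell_of_goodEvent`: hence, if `σ ≤ polDist(U_0)/2 − 2L²√s − nLt` with `σ > 0`, every plane line holonomy of every slice lies
  in the chart shell `exp(ι{arcsin σ ≤ ‖x‖ ≤ π − arcsin σ})` — the hypothesis `hAsh` of `OwnAxis.sectorWeight_indicator_le_of_ownShift`.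

HONEST FRAMING: fixed-lattice bookkeeping; nothing about infinite volume, the continuum limit or the Clay gap.  No `sorry`, no new axiom, no new
definition.  References: [cite: Luscher1983, §2]; [cite: SeilerLNP1982, §3].
-/

set_option autoImplicit false

noncomputable section

open scoped Quaternion BigOperators
open NormedSpace Function
open Literature.MathematicalPhysics.QuantumLattice (su2Quat su2Quat_ne_zero norm_su2Quat fundamentalRep_apply)
open Literature.MathematicalPhysics.QuantumFieldTheory hiding su2Quat_mul
open Literature.MathematicalPhysics.QuantumFieldTheory.Balaban1983to89.T4HaarSU2ExpChart (expPoint)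
open Literature.MathematicalPhysics.QuantumFieldTheory.Balaban1983to89.T4HaarSU2Translate (su2Quat_mul su2Quat_one)

namespace Summit.QuantumFields.YangMills.Theorems.FemtoTransferGap.OwnAxis

open ClassShift
open Summit.QuantumFields.YangMills.Theorems.FemtoTransferGap.TT (goodEvent mem_goodEvent_iff twist3_false)

variable {L : ℕ} [NeZero L]

/-! ## §1 The dictionary: actions and Frobenius closeness in quaternion currency -/

/-- One plaquette deficit is at most the action: `2 − Re tr U_{x;i,j} ≤ S(U)` for `i < j`. [folklore] -/
theorem two_sub_re_trace_le_wilsonAction (U : GaugeConfig 3 L SU2) (x : Site 3 L) {i j : Fin 3} (hij : i < j) :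
    2 - (((plaquetteHolonomy U x i j : SU2) : Matrix (Fin 2) (Fin 2) ℂ).trace).re ≤ wilsonAction su2Rep U := by
  have h1 : wilsonAction su2Rep U = ∑ p : Plaquette 3 L, (2 - ((su2Rep (plaquetteHolonomy U p.1 p.2.1.1 p.2.1.2)).trace).re) := by
    unfold wilsonAction; simp
  rw [h1]
  have hp := Finset.single_le_sum (f := fun p : Plaquette 3 L => (2 - ((su2Rep (plaquetteHolonomy U p.1 p.2.1.1 p.2.1.2)).trace).re))
    (fun p _ => by
      have := re_trace_le_two (plaquetteHolonomy U p.1 p.2.1.1 p.2.1.2)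
      simp only [fundamentalRep_apply]; linarith)
    (Finset.mem_univ ((x, ⟨(i, j), hij⟩) : Plaquette 3 L))
  simpa only [fundamentalRep_apply] using hp

omit [NeZero L] in
/-- Reversing the orientation inverts the plaquette holonomy. [folklore] -/
theorem plaquetteHolonomy_swap {G : Type*} [Group G] (U : GaugeConfig 3 L G) (x : Site 3 L) (i j : Fin 3) :
    plaquetteHolonomy U x j i = (plaquetteHolonomy U x i j)⁻¹ := by
  unfold plaquetteHolonomy; group

/-- ★ **Action bound ⇒ every plaquette symbol is `√s`-close to `1`**: `S(U) ≤ s ⇒ ‖q(U_{y;i,j}) − 1‖ ≤ √s` for ALL `y, i, j`. [folklore] -/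
theorem norm_su2Quat_plaquette_sub_one_le {U : GaugeConfig 3 L SU2} {s : ℝ} (hS : wilsonAction su2Rep U ≤ s) (y : Site 3 L) (i j : Fin 3) :
    ‖su2Quat (plaquetteHolonomy U y i j) - 1‖ ≤ Real.sqrt s := by
  have hs0 : 0 ≤ s := (wilsonAction_su2_nonneg_lat U).trans hS
  have key : ∀ {i j : Fin 3}, i < j → ‖su2Quat (plaquetteHolonomy U y i j) - 1‖ ≤ Real.sqrt s := by
    intro i j hij
    rw [norm_su2Quat_sub_one_eq_sqrt]
    exact Real.sqrt_le_sqrt ((two_sub_re_trace_le_wilsonAction U y hij).trans hS)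
  rcases lt_trichotomy i j with hij | rfl | hji
  · exact key hij
  · have : plaquetteHolonomy U y i i = 1 := by unfold plaquetteHolonomy; group
    rw [this, su2Quat_one, sub_self, norm_zero]; exact Real.sqrt_nonneg _
  · rw [plaquetteHolonomy_swap U y j i]
    have h := norm_su2Quat_sub_eq (1 : SU2) (plaquetteHolonomy U y j i)
    rw [su2Quat_one, one_mul, norm_sub_rev] at h
    rw [← h]
    exact key hji

/-- ★ **The good-field event of the untwisted sector in quaternion currency**: uniform plaquette bounds `√s` on every slice, and quaternion
`t`-closeness of the interior bonds and of the seam bond `(U_n, g·U_0)`. [cite: Luscher1983, §2] -/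
theorem goodEvent_dictionary {n : ℕ} {s t : ℝ} {p : (Site 3 L → SU2) × (Fin (n + 1) → GaugeConfig 3 L SU2)}
    (hp : p ∈ goodEvent (L := L) n (fun _ => false) s t) :
    (∀ (k : Fin (n + 1)) (y : Site 3 L) (i j : Fin 3), ‖su2Quat (plaquetteHolonomy (p.2 k) y i j) - 1‖ ≤ Real.sqrt s) ∧
    (∀ (i : Fin n) (e : Edge 3 L), ‖su2Quat (p.2 i.castSucc e) - su2Quat (p.2 i.succ e)‖ ≤ t) ∧
    (∀ e : Edge 3 L, ‖su2Quat (p.2 (Fin.last n) e) - su2Quat (gaugeTransform p.1 (p.2 0) e)‖ ≤ t) := by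
  obtain ⟨hA, hB, hC⟩ := (mem_goodEvent_iff n _ s t p).1 hp
  refine ⟨fun k y i j => norm_su2Quat_plaquette_sub_one_le (hA k).le y i j,
    fun i e => (norm_su2Quat_sub_le_frobNorm _ _).trans (hB i e), fun e => ?_⟩
  have h := hC e
  rw [twist3_false] at h
  exact (norm_su2Quat_sub_le_frobNorm _ _).trans h

/-! ## §2 Propagation of non-centrality -/

omit [NeZero L] in
/-- The `m`-th site in direction `k`: `(· + e_k)^[m] y = y + m e_k`. [folklore] -/
theorem iterate_shift_dir_eq (k : Fin 3) (y : Site 3 L) : ∀ m : ℕ, (fun z : Site 3 L => z.shift k)^[m] y = y + Pi.single k ((m : ℕ) : ZMod L)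
  | 0 => by simp
  | m + 1 => by
    rw [Function.iterate_succ_apply', iterate_shift_dir_eq k y m]
    simp only [Site.shift, add_assoc, ← Pi.single_add, Nat.cast_succ]

omit [NeZero L] in
/-- **One transverse step**: `|‖Im q(P(y+e_j))‖ − ‖Im q(P(y))‖| ≤ Lε` under a uniform plaquette bound `ε` (`j` arbitrary). [cite: Luscher1983, §2] -/
theorem abs_norm_imVec_shift_sub_le {U : GaugeConfig 3 L SU2} {ε : ℝ} (hP : ∀ (y : Site 3 L) (i j : Fin 3), ‖su2Quat (plaquetteHolonomy U y i j) - 1‖ ≤ ε)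
    (j : Fin 3) (y : Site 3 L) :
    |‖imVec (su2Quat (lineHolonomy U 0 L (y.shift j)))‖ - ‖imVec (su2Quat (lineHolonomy U 0 L y))‖| ≤ L * ε := by
  have h1 := norm_su2Quat_transport_closed_sub_le U j y
  have h2 := ladder_sum_le hP j y
  have hconj : ‖imVec (su2Quat (U (y, j) * lineHolonomy U 0 L (y.shift j) * (U (y, j))⁻¹))‖ = ‖imVec (su2Quat (lineHolonomy U 0 L (y.shift j)))‖ :=
    norm_imVec_su2Quat_conj _ _
  rw [← hconj]
  exact (abs_norm_imVec_sub_le _ _).trans (h1.trans h2)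

omit [NeZero L] in
/-- **`m` transverse steps**: `|‖Im q(P(y + m e_j))‖ − ‖Im q(P(y))‖| ≤ m L ε`. [folklore] -/
theorem abs_norm_imVec_iterate_shift_sub_le {U : GaugeConfig 3 L SU2} {ε : ℝ} (hP : ∀ (y : Site 3 L) (i j : Fin 3), ‖su2Quat (plaquetteHolonomy U y i j) - 1‖ ≤ ε)
    (j : Fin 3) (y : Site 3 L) : ∀ m : ℕ,
    |‖imVec (su2Quat (lineHolonomy U 0 L ((fun z : Site 3 L => z.shift j)^[m] y)))‖ - ‖imVec (su2Quat (lineHolonomy U 0 L y))‖| ≤ m * (L * ε)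
  | 0 => by simp
  | m + 1 => by
    rw [Function.iterate_succ_apply', Nat.cast_succ, add_mul, one_mul]
    have ih := abs_norm_imVec_iterate_shift_sub_le hP j y m
    have h1 := abs_norm_imVec_shift_sub_le hP j ((fun z : Site 3 L => z.shift j)^[m] y)
    calc _ ≤ |‖imVec (su2Quat (lineHolonomy U 0 L (((fun z : Site 3 L => z.shift j)^[m] y).shift j)))‖ -
              ‖imVec (su2Quat (lineHolonomy U 0 L ((fun z : Site 3 L => z.shift j)^[m] y)))‖| +
            |‖imVec (su2Quat (lineHolonomy U 0 L ((fun z : Site 3 L => z.shift j)^[m] y)))‖ - ‖imVec (su2Quat (lineHolonomy U 0 L y))‖| :=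
          abs_sub_le _ _ _
      _ ≤ L * ε + m * (L * ε) := add_le_add h1 ih
      _ = m * (L * ε) + L * ε := add_comm _ _

/-- Every plane site is reached from the origin by `x₁` steps along `e₁` and `x₂` steps along `e₂`. [folklore] -/
theorem plane_site_eq_iterate {x : Site 3 L} (hx : x 0 = 0) :
    x = (fun z : Site 3 L => z.shift 2)^[(x 2).val] ((fun z : Site 3 L => z.shift 1)^[(x 1).val] 0) := by
  rw [iterate_shift_dir_eq, iterate_shift_dir_eq, ZMod.natCast_zmod_val, ZMod.natCast_zmod_val, zero_add]
  funext k
  fin_cases k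
  · simp [hx]
  · simp
  · simp

/-- ★ **Transverse propagation**: `‖Im q(P_x)‖ ≥ ‖Im q(P_0)‖ − 2L²ε` for every plane site `x`. [cite: Luscher1983, §2] -/
theorem norm_imVec_lineHolonomy_plane_ge {U : GaugeConfig 3 L SU2} {ε : ℝ} (hP : ∀ (y : Site 3 L) (i j : Fin 3), ‖su2Quat (plaquetteHolonomy U y i j) - 1‖ ≤ ε)
    {x : Site 3 L} (hx : x 0 = 0) :
    ‖imVec (su2Quat (lineHolonomy U 0 L 0))‖ - 2 * (L * (L * ε)) ≤ ‖imVec (su2Quat (lineHolonomy U 0 L x))‖ := by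
  have hε : 0 ≤ ε := (norm_nonneg _).trans (hP 0 0 1)
  have hL : (0 : ℝ) ≤ L := Nat.cast_nonneg _
  set y : Site 3 L := (fun z : Site 3 L => z.shift 1)^[(x 1).val] 0 with hy
  have h1 := abs_norm_imVec_iterate_shift_sub_le hP 1 (0 : Site 3 L) (x 1).val
  have h2 := abs_norm_imVec_iterate_shift_sub_le hP 2 y (x 2).val
  rw [← hy] at h1
  rw [← plane_site_eq_iterate hx] at h2
  have hv1 : ((x 1).val : ℝ) * (L * ε) ≤ L * (L * ε) :=
    mul_le_mul_of_nonneg_right (by exact_mod_cast (ZMod.val_lt (x 1)).le) (by positivity)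
  have hv2 : ((x 2).val : ℝ) * (L * ε) ≤ L * (L * ε) :=
    mul_le_mul_of_nonneg_right (by exact_mod_cast (ZMod.val_lt (x 2)).le) (by positivity)
  have := abs_le.1 h1
  have := abs_le.1 h2
  linarith

omit [NeZero L] in
/-- ★ **Time propagation along the ring**: with interior bonds `τ`-close, `|‖Im q(P_x(U_k))‖ − ‖Im q(P_x(U_0))‖| ≤ k · Lτ`. [folklore] -/
theorem abs_norm_imVec_slice_sub_le {n : ℕ} {Us : Fin (n + 1) → GaugeConfig 3 L SU2} {τ : ℝ}
    (hTi : ∀ (i : Fin n) (e : Edge 3 L), ‖su2Quat (Us i.castSucc e) - su2Quat (Us i.succ e)‖ ≤ τ) (x : Site 3 L) :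
    ∀ (k : ℕ) (hk : k < n + 1),
      |‖imVec (su2Quat (lineHolonomy (Us ⟨k, hk⟩) 0 L x))‖ - ‖imVec (su2Quat (lineHolonomy (Us 0) 0 L x))‖| ≤ k * (L * τ)
  | 0, _ => by simp
  | k + 1, hk => by
    have hk' : k < n + 1 := by omega
    have ih := abs_norm_imVec_slice_sub_le hTi x k hk'
    set i : Fin n := ⟨k, by omega⟩ with hi
    have hcs : i.castSucc = ⟨k, hk'⟩ := rfl
    have hsu : i.succ = ⟨k + 1, hk⟩ := rfl
    have hstep : ‖su2Quat (lineHolonomy (Us ⟨k + 1, hk⟩) 0 L x) - su2Quat (lineHolonomy (Us ⟨k, hk'⟩) 0 L x)‖ ≤ L * τ := by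
      rw [← hcs, ← hsu, norm_sub_rev]
      exact norm_su2Quat_lineHolonomy_sub_le_mul (hTi i) x
    rw [Nat.cast_succ, add_mul, one_mul]
    calc _ ≤ |‖imVec (su2Quat (lineHolonomy (Us ⟨k + 1, hk⟩) 0 L x))‖ - ‖imVec (su2Quat (lineHolonomy (Us ⟨k, hk'⟩) 0 L x))‖| +
            |‖imVec (su2Quat (lineHolonomy (Us ⟨k, hk'⟩) 0 L x))‖ - ‖imVec (su2Quat (lineHolonomy (Us 0) 0 L x))‖| := abs_sub_le _ _ _
      _ ≤ L * τ + k * (L * τ) := add_le_add ((abs_norm_imVec_sub_le _ _).trans hstep) ih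
      _ = k * (L * τ) + L * τ := add_comm _ _

/-- ★ **The non-centrality floor on the good-field event**: for `p ∈ goodEvent n 0 s t`, every slice `k` and every plane site `x`,
`‖Im q(P_x(U_k))‖ ≥ polDist(U_0)/2 − 2L²√s − nLt`. [cite: Luscher1983, §2] -/
theorem norm_imVec_lineHolonomy_ge_of_goodEvent {n : ℕ} {s t : ℝ} {p : (Site 3 L → SU2) × (Fin (n + 1) → GaugeConfig 3 L SU2)}
    (hp : p ∈ goodEvent (L := L) n (fun _ => false) s t) (k : Fin (n + 1)) {x : Site 3 L} (hx : x 0 = 0) :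
    FlatSheet.polDist (p.2 0) / 2 - 2 * (L * (L * Real.sqrt s)) - n * (L * t) ≤ ‖imVec (su2Quat (lineHolonomy (p.2 k) 0 L x))‖ := by
  obtain ⟨hP, hTi, -⟩ := goodEvent_dictionary hp
  have h0 : FlatSheet.polDist (p.2 0) / 2 ≤ ‖imVec (su2Quat (lineHolonomy (p.2 0) 0 L 0))‖ := by
    unfold FlatSheet.polDist
    rw [polyX_eq_lineHolonomy]
    exact half_vacDist_le_norm_imVec _
  have h1 := norm_imVec_lineHolonomy_plane_ge (hP 0) hx
  have h2 := abs_norm_imVec_slice_sub_le hTi x k.val k.isLt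
  have hk : ((k.val : ℕ) : ℝ) * (L * t) ≤ n * (L * t) := by
    rcases Nat.eq_zero_or_pos n with hn | hn
    · subst hn
      rw [show ((k.val : ℕ) : ℝ) = 0 by exact_mod_cast (show k.val = 0 by omega)]
      simp
    · have hτ : 0 ≤ t := (norm_nonneg _).trans (hTi ⟨0, hn⟩ ((0 : Site 3 L), 0))
      exact mul_le_mul_of_nonneg_right (by exact_mod_cast Nat.lt_succ_iff.1 k.isLt) (by positivity)
  have hk2 : (⟨k.val, k.isLt⟩ : Fin (n + 1)) = k := rfl
  rw [hk2] at h2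
  have := abs_le.1 h2
  linarith

/-! ## §3 The shell event -/

/-- ★ **Every plane line of every slice is in the chart shell**: if `p ∈ goodEvent n 0 s t` and `0 < σ ≤ polDist(U_0)/2 − 2L²√s − nLt`, then for every
slice `k` and plane site `x` the holonomy `P_x(U_k)` lies in `exp(ι{arcsin σ ≤ ‖v‖ ≤ π − arcsin σ})`. [cite: Luscher1983, §2] -/
theorem lineHolonomy_mem_shell_of_goodEvent {n : ℕ} {s t σ : ℝ} (hσ : 0 < σ) {p : (Site 3 L → SU2) × (Fin (n + 1) → GaugeConfig 3 L SU2)}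
    (hp : p ∈ goodEvent (L := L) n (fun _ => false) s t)
    (hσle : σ ≤ FlatSheet.polDist (p.2 0) / 2 - 2 * (L * (L * Real.sqrt s)) - n * (L * t)) (k : Fin (n + 1)) {x : Site 3 L} (hx : x 0 = 0) :
    lineHolonomy (p.2 k) 0 L x ∈ expPoint '' {v : EuclideanSpace ℝ (Fin 3) | Real.arcsin σ ≤ ‖v‖ ∧ ‖v‖ ≤ Real.pi - Real.arcsin σ} :=
  mem_image_expPoint_shell_of_le_norm_imVec hσ (hσle.trans (norm_imVec_lineHolonomy_ge_of_goodEvent hp k hx))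

/-- The floor itself, as used by the cost module: `σ ≤ ‖Im q(P_x(U_k))‖`. [folklore] -/
theorem floor_of_goodEvent {n : ℕ} {s t σ : ℝ} {p : (Site 3 L → SU2) × (Fin (n + 1) → GaugeConfig 3 L SU2)}
    (hp : p ∈ goodEvent (L := L) n (fun _ => false) s t)
    (hσle : σ ≤ FlatSheet.polDist (p.2 0) / 2 - 2 * (L * (L * Real.sqrt s)) - n * (L * t)) (k : Fin (n + 1)) (x : Site 3 L) (hx : x 0 = 0) :
    σ ≤ ‖imVec (su2Quat (lineHolonomy (p.2 k) 0 L x))‖ :=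
  hσle.trans (norm_imVec_lineHolonomy_ge_of_goodEvent hp k hx)

end Summit.QuantumFields.YangMills.Theorems.FemtoTransferGap.OwnAxis

end
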